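/-
Copyright (c) 2026. All rights reserved.
Released under Apache 2.0 license as described in the file LICENSE.
Authors: abc-iut cell, prover seat abc-iut-w5-d038 (gen 8; row «ARC-MTC-F3» (L4-lead m134), part F3b: the CONTENT of
the archimedean `η⊢_{v,ν}` of [AbsTopIII] Cor 5.10 (iv)(c) at the cross vertex `ν = pre` (`k∼`), over abc-iut-L4-t8's
genuine `TB⊞`-leg (Def 5.6 (iv)) and abc-iut-w6-d025's `k∼(G)` (Prop 5.8 (iv)(v)); naturality = F3a p486655 +
F3a′ p487676).
-/
import Literature.AnabelianGeometry.AbsoluteAnabelian.ArchimedeanHolGroupPairsTBPlusFunctor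
import Literature.AnabelianGeometry.AbsoluteAnabelian.ArchimedeanHolGroupPairsLambda
import Literature.AnabelianGeometry.AbsoluteAnabelian.AutHolFieldFunctorOrientationCoherent
import Literature.AnabelianGeometry.AbsoluteAnabelian.MonoAnalyticArchGammaFunctor
import Literature.AnabelianGeometry.AbsoluteAnabelian.TBPlusULift
import HarnessLib

/-!
# The archimedean `η⊢_{v,ν}` at the vertex `pre`: `(k∼)^{TB⊞} ⥲ k∼(G_𝕏)`, naturally in `(𝕏 ↶ k)` ([AbsTopIII] Cor 5.10 (iv)(c))

S. Mochizuki, *Topics in absolute anabelian geometry III*, Cor 5.10 (iv)(c) p. 148 l. 10–37, VERBATIM (v2, referee lane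
L14-n6; arrow labels `λ⊞_{v,ν}`, `φ^{An⊢⊞}_{v,ν}` and the clause on `D•_{≤5}`/`D⊢` dropped at «…»): «there is a natural
isomorphism `η⊢_{v,ν}` from the composite functor determined by the path `γ¹_{v,ν}` [of length 6] `𝒳 → 𝒩⊞_v → 𝒩_v → ℰ• →
ℰ⊢ → An⊢[𝒩⊢⊞] → 𝒩⊢⊞_v` … to the composite functor determined by the path `γ⁰_{v,ν}` [of length 2] `𝒳 → 𝒩⊞_v → 𝒩⊢⊞_v`», for
`v ∈ V^arc` (GLOSS: `γ⁰` = `λ⊞_{v,ν}` followed by the mono-analyticization `𝒞^hol_{TH⊞} → 𝒞^{hol⊢}_{TB⊞}` of Def 5.6 (iv);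
`γ¹` = the underlying `𝕏`, its `G_𝕏 ∈ TM⊢`, then `ψ^{An⊢⊞}_{v,ν}`; this file's `etaTilde` is typed `γ⁰ ≅ γ¹`, print's `η⊢`
is its inverse). This file is its CONTENT at the cross vertex `ν = pre` (`k∼ = (k, +)`, Def 5.4 (v)), on the
`TB⊞`-components (the `TM⊢`-components agree on the nose in the tree's archimedean settings,
`LogFrobeniusArchGenuineMonoAn`):

* the two legs are honest functors `𝒳 = HolTFPair 𝔄 ⥤ TB⊞`: `λ⊞_pre ⋙ (TH⊞ → TB⊞)` (abc-iut-L4-t8's `HolTFPair.lamSimPlus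
  ⋙ HolTHPlusPair.toTBPlus`, Def 5.4 (vi) / Def 5.6 (iv): `B = k`, `B′ = e⁻¹(iℝ)`, `B″ = e⁻¹(ℝ)` through THE CAF chart
  `e_𝕏 = cafChart ∘ κ`, lifted one universe by abc-iut-w6-d025's `TBPlus.uliftFunctor`) and `(𝕏 ↶ k) ↦ 𝕏 ↦ G_𝕏 ↦ k∼(G_𝕏)`
  (`HolTFPair.toEA ⋙ AutHolFieldFunctor.toTMMono ⋙ TMMono.kTilde`, abc-iut-w6-d025, Prop 5.8 (iv)(v): `k∼(G) = C∼ × C∼ = ℝ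
  × ℝ`, a morphism `G_f` acting by its sign `σ(G_f)` on both factors);
* ★ `HolTFPair.etaTildeIso x` — the `TB⊞`-ISOMORPHISM `(k, e⁻¹(iℝ), e⁻¹(ℝ), 1) ⥲ (ℝ × ℝ, ℝ × 0, 0 × ℝ, 1)`, `b ↦ (σ_𝕏 · Im
  e_𝕏(b), c_𝕏 σ_𝕏 · Re e_𝕏(b))`, rescalings `a₁ = σ_𝕏` (abc-iut-w5-d038's chart sign `AutHolFieldFunctor.chartSign`,
  comparing `e_𝕏` with `TMMono.chart G_𝕏`) and `a₂ = c_𝕏 σ_𝕏`, for an orientation cochain `c : Ob(EA) → {±1}`;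
* ★★ `HolTFPair.etaTilde 𝔄 c hc hcob : lamSimPlus 𝔄 ⋙ toTBPlus 𝔄 ⋙ TBPlus.uliftFunctor ≅ toEA 𝔄 ⋙ 𝔄.toTMMono ⋙
  TMMono.kTilde` — NATURAL in `(𝕏 ↶ k)` as soon as the transition signs are the coboundary of `c` (`hcob : ε_f = c_𝕏
  c_𝕐`): naturality is F3a's `sign(G_f) = ε_f σ_𝕏 σ_𝕐` (`sign_toTMMono_map_eq`, p486655) read against `k∼(G_f) = σ(G_f) •
  (-)`; and F3a′ (`not_exists_cochain_of_sign_endo_eq_neg_one`, p487676) says the coboundary condition is NECESSARY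
  (`k∼(G_f)` rescales `B″` by `σ(G_f)`, the `TB⊞`-leg by `+1`);
* ★★ `HolRS.nonempty_etaTilde_geometric Q` — UNCONDITIONAL at the geometric Aut-holomorphic field functor of a class `Q`
  of hyperbolic Riemann surfaces (`HolRS.exists_orientationCochain_geometric`, p487676: there `ε_f = 1`).

Honest limits: the vertex `ν = mult` (`k^× ⥲ k×(G)`, an `AddCircle` angle) and the packaging as a
`LogFrobeniusSetting.MonoTelecoreCoherence` at a `Plus`-setting (`Nplus v := 𝒞^hol_{TH⊞}`) are separate files;
MODEL-LEVEL; nothing here bears on the disputed [IUTchIII] Cor. 3.12; typed ≠ proved.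
-/

set_option autoImplicit false

universe u

open CategoryTheory Complex

namespace Literature.AnabelianGeometry.AbsoluteAnabelian

/-! ## §1. The transition automorphism in coordinates: `Re` is kept, `Im` is multiplied by `ε_f` -/

namespace AutHolFieldFunctor

variable {𝔄 : AutHolFieldFunctor.{u}}

/-- `transition f` fixes real parts and multiplies imaginary parts by the transition sign `ε_f` (it is the identity or
complex conjugation, Rmk 5.8.1 (i)). [cite: MochizukiAbsTopIII2015, Rmk 5.8.1 (i) p.142] -/
theorem re_transition_and_im_transition {X Y : 𝔄.EA} (f : X ⟶ Y) (z : ℂ) :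
    (transition f z).re = z.re ∧ (transition f z).im = transitionSign f * z.im := by
  unfold transitionSign
  by_cases h : (transition f).toRingHom = RingHom.id ℂ
  · rw [if_pos h]
    have hz : transition f z = z := by change (transition f).toRingHom z = z; rw [h]; rfl
    rw [hz, one_mul]
    exact ⟨rfl, rfl⟩
  · rw [if_neg h]
    have h' := (transition_eq_id_or_conj f).resolve_left h
    have hz : transition f z = starRingEnd ℂ z := by change (transition f).toRingHom z = _; rw [h']
    rw [hz, conj_re, conj_im, neg_one_mul]
    exact ⟨rfl, rfl⟩

/-- `Re (transition f z) = Re z`. [cite: MochizukiAbsTopIII2015, Rmk 5.8.1 (i) p.142] -/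
theorem re_transition {X Y : 𝔄.EA} (f : X ⟶ Y) (z : ℂ) : (transition f z).re = z.re :=
  (re_transition_and_im_transition f z).1

/-- `Im (transition f z) = ε_f · Im z`. [cite: MochizukiAbsTopIII2015, Rmk 5.8.1 (i) p.142] -/
theorem im_transition {X Y : 𝔄.EA} (f : X ⟶ Y) (z : ℂ) : (transition f z).im = transitionSign f * z.im :=
  (re_transition_and_im_transition f z).2

end AutHolFieldFunctor

/-! ## §2. The CAF chart of `λ⊞_pre(𝕏 ↶ k)` along a morphism, and its one-parameter subgroups in the chart -/

namespace HolTFPair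

variable {𝔄 : AutHolFieldFunctor.{u}}

/-- THE CAF chart of a `TF`-pair `(𝕏 ↶ k)`: `e_𝕏 ∘ κ : k ⥲ ℂ` (the Kummer structure followed by the chosen CAF chart of
`𝒜_𝕏`; it is `HolTHPlusPair.chart` of `λ⊞(𝕏 ↶ k)`, see `chart_lamSimPlusObj`). [cite: MochizukiAbsTopIII2015, Definition 5.6 (iv) p.136] -/
noncomputable def cafChart (x : HolTFPair 𝔄) : x.k ≃+* ℂ := x.κ.trans (𝔄.cafChart x.X)

/-- `e(m) = cafChart_𝕏 (κ m)`. [cite: MochizukiAbsTopIII2015, Definition 5.6 (iv) p.136] -/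
theorem cafChart_apply (x : HolTFPair 𝔄) (m : x.k) : x.cafChart m = 𝔄.cafChart x.X (x.κ m) := rfl

/-- The CAF chart of `λ⊞_pre(𝕏 ↶ k)` is the CAF chart of `(𝕏 ↶ k)`. [cite: MochizukiAbsTopIII2015, Definition 5.6 (iv) p.136] -/
theorem chart_lamSimPlusObj (x : HolTFPair 𝔄) : x.cafChart = x.cafChart := rfl

/-- The CAF chart of `λ⊞_mult(𝕏 ↶ k)` is the CAF chart of `(𝕏 ↶ k)`. [cite: MochizukiAbsTopIII2015, Definition 5.6 (iv) p.136] -/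
theorem chart_lamTimesPlusObj (x : HolTFPair 𝔄) : (lamTimesPlusObj x).chart = x.cafChart := rfl

/-- The CAF chart is continuous. [cite: MochizukiAbsTopIII2015, Definition 5.6 (iv) p.136] -/
theorem continuous_cafChart (x : HolTFPair 𝔄) : Continuous x.cafChart :=
  (𝔄.continuous_cafChart x.X).comp x.continuous_κ

/-- The inverse CAF chart is continuous. [cite: MochizukiAbsTopIII2015, Definition 5.6 (iv) p.136] -/
theorem continuous_cafChart_symm (x : HolTFPair 𝔄) : Continuous x.cafChart.symm :=
  x.continuous_κ_symm.comp (𝔄.continuous_cafChart_symm x.X)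

/-- The CAF chart `e = cafChart ∘ κ` of `(𝕏 ↶ k)` along a morphism `φ`: `e_𝕐(φ_M m) = transition(φ_𝕏)(e_𝕏 m)`
(compatibility of `φ_M` with the Kummer structures). [cite: MochizukiAbsTopIII2015, Definition 4.1 (ii) p.102] -/
theorem cafChart_arith {x y : HolTFPair 𝔄} (φ : x ⟶ y) (m : x.k) :
    y.cafChart (φ.arith m) = AutHolFieldFunctor.transition φ.base (x.cafChart m) := by
  rw [cafChart_apply, cafChart_apply, φ.compat, AutHolFieldFunctor.transition_apply_cafChart]

/-- `Im e_𝕐(φ_M m) = ε_{φ_𝕏} · Im e_𝕏(m)`. [cite: MochizukiAbsTopIII2015, Rmk 5.8.1 (i) p.142] -/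
theorem im_cafChart_arith {x y : HolTFPair 𝔄} (φ : x ⟶ y) (m : x.k) :
    (y.cafChart (φ.arith m)).im = AutHolFieldFunctor.transitionSign φ.base * (x.cafChart m).im := by
  rw [cafChart_arith, AutHolFieldFunctor.im_transition]

/-- `Re e_𝕐(φ_M m) = Re e_𝕏(m)`. [cite: MochizukiAbsTopIII2015, Rmk 5.8.1 (i) p.142] -/
theorem re_cafChart_arith {x y : HolTFPair 𝔄} (φ : x ⟶ y) (m : x.k) :
    (y.cafChart (φ.arith m)).re = (x.cafChart m).re := by
  rw [cafChart_arith, AutHolFieldFunctor.re_transition]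

/-- `B′` of `(k∼)^{TB⊞}` in the chart: `c₁(s) = e⁻¹(i s)`. [cite: MochizukiAbsTopIII2015, Definition 5.6 (iv) p.136] -/
theorem toTBPlusObj_lamSimPlusObj_c₁ (x : HolTFPair 𝔄) (s : ℝ) :
    ((lamSimPlusObj x).toTBPlusObj.c₁ s : x.k) = x.cafChart.symm (I * s) := rfl

/-- `B″` of `(k∼)^{TB⊞}` in the chart: `c₂(t) = e⁻¹(t)`. [cite: MochizukiAbsTopIII2015, Definition 5.6 (iv) p.136] -/
theorem toTBPlusObj_lamSimPlusObj_c₂ (x : HolTFPair 𝔄) (t : ℝ) :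
    ((lamSimPlusObj x).toTBPlusObj.c₂ t : x.k) = x.cafChart.symm ((1 : ℂ) * t) := rfl

/-! ## §3. The component `η⊢_𝕏 : (k, e⁻¹(iℝ), e⁻¹(ℝ), 1) ⥲ k∼(G_𝕏) = (ℝ × ℝ, ℝ × 0, 0 × ℝ, 1)` -/

/-- A sign squares to one. [folklore] -/
private theorem mul_self_of_eq_one_or {a : ℝ} (h : a = 1 ∨ a = -1) : a * a = 1 := by
  rcases h with h | h <;> rw [h] <;> norm_num

/-- A sign has absolute value one. [folklore] -/
private theorem abs_of_eq_one_or {a : ℝ} (h : a = 1 ∨ a = -1) : |a| = 1 := by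
  rcases h with h | h <;> rw [h] <;> norm_num

section Component

variable (c : 𝔄.EA → ℝ) (x : HolTFPair 𝔄)

/-- The homomorphism of `η⊢_𝕏`: `b ↦ (σ_𝕏 · Im e_𝕏(b), c_𝕏 σ_𝕏 · Re e_𝕏(b)) : k → C∼ × C∼` (`B′ = e⁻¹(iℝ) → C∼ × 0`,
`B″ = e⁻¹(ℝ) → 0 × C∼`). [cite: MochizukiAbsTopIII2015, Cor 5.10 (iv)(c) p.148] -/
noncomputable def etaTildeHom : ULift.{u + 1} x.k →ₜ+ TMMono.TildeCarrier.{u + 1} where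
  toFun b := ULift.up (𝔄.chartSign x.X * (x.cafChart b.down).im,
    c x.X * 𝔄.chartSign x.X * (x.cafChart b.down).re)
  map_zero' := by
    change ULift.up (𝔄.chartSign x.X * (x.cafChart 0).im,
      c x.X * 𝔄.chartSign x.X * (x.cafChart 0).re) = _
    rw [map_zero, zero_im, zero_re, mul_zero, mul_zero]
    rfl
  map_add' a b := by
    change ULift.up (𝔄.chartSign x.X * (x.cafChart (a.down + b.down)).im,
      c x.X * 𝔄.chartSign x.X * (x.cafChart (a.down + b.down)).re) = _
    rw [map_add, add_im, add_re, mul_add, mul_add]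
    rfl
  continuous_toFun := by
    have h : Continuous fun b : ULift.{u + 1} x.k => x.cafChart b.down :=
      x.continuous_cafChart.comp continuous_uliftDown
    exact continuous_uliftUp.comp ((continuous_const.mul (continuous_im.comp h)).prodMk
      (continuous_const.mul (continuous_re.comp h)))

/-- `η⊢_𝕏` on elements. [cite: MochizukiAbsTopIII2015, Cor 5.10 (iv)(c) p.148] -/
@[simp] theorem etaTildeHom_apply (b : ULift.{u + 1} x.k) :
    etaTildeHom c x b = ULift.up (𝔄.chartSign x.X * (x.cafChart b.down).im,
      c x.X * 𝔄.chartSign x.X * (x.cafChart b.down).re) := rfl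

/-- The inverse homomorphism: `(p, q) ↦ e_𝕏⁻¹(c_𝕏 σ_𝕏 q + i σ_𝕏 p)`. [cite: MochizukiAbsTopIII2015, Cor 5.10 (iv)(c) p.148] -/
noncomputable def etaTildeInv : TMMono.TildeCarrier.{u + 1} →ₜ+ ULift.{u + 1} x.k where
  toFun p := ULift.up (x.cafChart.symm
    (((c x.X * 𝔄.chartSign x.X * p.down.2 : ℝ) : ℂ) + I * ((𝔄.chartSign x.X * p.down.1 : ℝ) : ℂ)))
  map_zero' := by
    change ULift.up (x.cafChart.symm
      (((c x.X * 𝔄.chartSign x.X * 0 : ℝ) : ℂ) + I * ((𝔄.chartSign x.X * 0 : ℝ) : ℂ))) = _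
    rw [mul_zero, mul_zero, ofReal_zero, mul_zero, add_zero, map_zero]
    rfl
  map_add' p q := by
    change ULift.up (x.cafChart.symm
      (((c x.X * 𝔄.chartSign x.X * (p.down.2 + q.down.2) : ℝ) : ℂ) +
        I * ((𝔄.chartSign x.X * (p.down.1 + q.down.1) : ℝ) : ℂ))) =
      ULift.up (x.cafChart.symm
        (((c x.X * 𝔄.chartSign x.X * p.down.2 : ℝ) : ℂ) + I * ((𝔄.chartSign x.X * p.down.1 : ℝ) : ℂ)) +
        x.cafChart.symm
        (((c x.X * 𝔄.chartSign x.X * q.down.2 : ℝ) : ℂ) + I * ((𝔄.chartSign x.X * q.down.1 : ℝ) : ℂ)))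
    rw [← map_add]
    refine congrArg ULift.up (congrArg x.cafChart.symm ?_)
    push_cast
    ring
  continuous_toFun := by
    refine continuous_uliftUp.comp (x.continuous_cafChart_symm.comp ?_)
    exact (continuous_ofReal.comp (continuous_const.mul (continuous_snd.comp continuous_uliftDown))).add
      (continuous_const.mul (continuous_ofReal.comp
        (continuous_const.mul (continuous_fst.comp continuous_uliftDown))))

/-- The inverse on elements. [cite: MochizukiAbsTopIII2015, Cor 5.10 (iv)(c) p.148] -/
@[simp] theorem etaTildeInv_apply (p : TMMono.TildeCarrier.{u + 1}) :
    etaTildeInv c x p = ULift.up (x.cafChart.symm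
      (((c x.X * 𝔄.chartSign x.X * p.down.2 : ℝ) : ℂ) + I * ((𝔄.chartSign x.X * p.down.1 : ℝ) : ℂ))) := rfl

variable (hc : ∀ X : 𝔄.EA, c X = 1 ∨ c X = -1)
include hc

/-- `η⊢_𝕏⁻¹ ∘ η⊢_𝕏 = id` (`σ² = c² = 1`, `z = Re z + i Im z`). [cite: MochizukiAbsTopIII2015, Cor 5.10 (iv)(c) p.148] -/
theorem etaTildeInv_etaTildeHom (b : ULift.{u + 1} x.k) : etaTildeInv c x (etaTildeHom c x b) = b := by
  have h₁ := mul_self_of_eq_one_or (hc x.X)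
  have h₂ := 𝔄.chartSign_mul_self x.X
  rw [etaTildeHom_apply, etaTildeInv_apply]
  refine congrArg ULift.up ?_
  have hre : c x.X * 𝔄.chartSign x.X * (c x.X * 𝔄.chartSign x.X * (x.cafChart b.down).re) =
      (x.cafChart b.down).re := by
    calc _ = (c x.X * c x.X) * (𝔄.chartSign x.X * 𝔄.chartSign x.X) * (x.cafChart b.down).re := by ring
      _ = _ := by rw [h₁, h₂, one_mul, one_mul]
  have him : 𝔄.chartSign x.X * (𝔄.chartSign x.X * (x.cafChart b.down).im) =
      (x.cafChart b.down).im := by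
    rw [← mul_assoc, h₂, one_mul]
  rw [hre, him, mul_comm I, re_add_im, RingEquiv.symm_apply_apply]

/-- `η⊢_𝕏 ∘ η⊢_𝕏⁻¹ = id`. [cite: MochizukiAbsTopIII2015, Cor 5.10 (iv)(c) p.148] -/
theorem etaTildeHom_etaTildeInv (p : TMMono.TildeCarrier.{u + 1}) : etaTildeHom c x (etaTildeInv c x p) = p := by
  have h₁ := mul_self_of_eq_one_or (hc x.X)
  have h₂ := 𝔄.chartSign_mul_self x.X
  rw [etaTildeInv_apply, etaTildeHom_apply]
  refine congrArg ULift.up ?_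
  rw [RingEquiv.apply_symm_apply]
  simp only [add_im, ofReal_im, mul_im, I_re, I_im, ofReal_re, zero_mul, one_mul, zero_add, add_re, mul_re,
    mul_zero, sub_zero, add_zero]
  refine Prod.ext ?_ ?_
  · calc _ = (𝔄.chartSign x.X * 𝔄.chartSign x.X) * p.down.1 := by ring
      _ = p.down.1 := by rw [h₂, one_mul]
  · calc _ = (c x.X * c x.X) * (𝔄.chartSign x.X * 𝔄.chartSign x.X) * p.down.2 := by ring
      _ = p.down.2 := by rw [h₁, h₂, one_mul, one_mul]

/-- **`η⊢_𝕏` as a morphism of `TB⊞`** `(k, e⁻¹(iℝ), e⁻¹(ℝ), 1) → k∼(G_𝕏)`: rescalings `a₁ = σ_𝕏`, `a₂ = c_𝕏 σ_𝕏`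
(`c₁(s) = e⁻¹(is) ↦ (σ s, 0)`, `c₂(t) = e⁻¹(t) ↦ (0, c σ t)`; `|c σ| · 1 = 1 · |σ|`).
[cite: MochizukiAbsTopIII2015, Cor 5.10 (iv)(c) p.148] -/
noncomputable def etaTildeApp : TBPlus.uliftObj.{u + 1} (lamSimPlusObj x).toTBPlusObj ⟶ TMMono.kTildeObj.{u + 1} where
  toHom := etaTildeHom c x
  surjective p := ⟨etaTildeInv c x p, etaTildeHom_etaTildeInv c x hc p⟩
  a₁ := 𝔄.chartSign x.X
  a₂ := c x.X * 𝔄.chartSign x.X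
  map_c₁ s := by
    change etaTildeHom c x (ULift.up ((lamSimPlusObj x).toTBPlusObj.c₁ s)) = ULift.up (𝔄.chartSign x.X * s, 0)
    rw [etaTildeHom_apply]
    refine congrArg ULift.up ?_
    change (𝔄.chartSign x.X * (x.cafChart (x.cafChart.symm (I * s))).im,
      c x.X * 𝔄.chartSign x.X * (x.cafChart (x.cafChart.symm (I * s))).re) = _
    rw [RingEquiv.apply_symm_apply, I_mul_im, ofReal_re, I_mul_re, ofReal_im, neg_zero, mul_zero]
  map_c₂ t := by
    change etaTildeHom c x (ULift.up ((lamSimPlusObj x).toTBPlusObj.c₂ t)) =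
      ULift.up (0, c x.X * 𝔄.chartSign x.X * t)
    rw [etaTildeHom_apply]
    refine congrArg ULift.up ?_
    change (𝔄.chartSign x.X * (x.cafChart (x.cafChart.symm ((1 : ℂ) * t))).im,
      c x.X * 𝔄.chartSign x.X * (x.cafChart (x.cafChart.symm ((1 : ℂ) * t))).re) = _
    rw [RingEquiv.apply_symm_apply, one_mul, ofReal_im, ofReal_re, mul_zero]
  map_β := by
    change |c x.X * 𝔄.chartSign x.X| * (1 : ℝ) = 1 * |𝔄.chartSign x.X|
    rw [abs_mul, abs_of_eq_one_or (hc x.X), mul_one]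

/-- `η⊢_𝕏` acts by `etaTildeHom`. [cite: MochizukiAbsTopIII2015, Cor 5.10 (iv)(c) p.148] -/
@[simp] theorem etaTildeApp_toHom : (etaTildeApp c x hc).toHom = etaTildeHom c x := rfl

/-- `a₁(η⊢_𝕏) = σ_𝕏`. [cite: MochizukiAbsTopIII2015, Cor 5.10 (iv)(c) p.148] -/
@[simp] theorem etaTildeApp_a₁ : (etaTildeApp c x hc).a₁ = 𝔄.chartSign x.X := rfl

/-- `a₂(η⊢_𝕏) = c_𝕏 σ_𝕏`. [cite: MochizukiAbsTopIII2015, Cor 5.10 (iv)(c) p.148] -/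
@[simp] theorem etaTildeApp_a₂ : (etaTildeApp c x hc).a₂ = c x.X * 𝔄.chartSign x.X := rfl

/-- **The inverse `η⊢_𝕏⁻¹ : k∼(G_𝕏) → (k∼)^{TB⊞}`** as a morphism of `TB⊞` (rescalings `σ_𝕏`, `c_𝕏 σ_𝕏` again —
signs are involutions). [cite: MochizukiAbsTopIII2015, Cor 5.10 (iv)(c) p.148] -/
noncomputable def etaTildeAppInv : TMMono.kTildeObj.{u + 1} ⟶ TBPlus.uliftObj.{u + 1} (lamSimPlusObj x).toTBPlusObj where
  toHom := etaTildeInv c x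
  surjective b := ⟨etaTildeHom c x b, etaTildeInv_etaTildeHom c x hc b⟩
  a₁ := 𝔄.chartSign x.X
  a₂ := c x.X * 𝔄.chartSign x.X
  map_c₁ s := by
    change etaTildeInv c x (ULift.up (s, 0)) = ULift.up ((lamSimPlusObj x).toTBPlusObj.c₁ (𝔄.chartSign x.X * s))
    rw [etaTildeInv_apply]
    refine congrArg ULift.up ?_
    change _ = x.cafChart.symm (I * ((𝔄.chartSign x.X * s : ℝ) : ℂ))
    rw [mul_zero, ofReal_zero, zero_add]
  map_c₂ t := by
    change etaTildeInv c x (ULift.up (0, t)) =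
      ULift.up ((lamSimPlusObj x).toTBPlusObj.c₂ (c x.X * 𝔄.chartSign x.X * t))
    rw [etaTildeInv_apply]
    refine congrArg ULift.up ?_
    change _ = x.cafChart.symm ((1 : ℂ) * ((c x.X * 𝔄.chartSign x.X * t : ℝ) : ℂ))
    rw [mul_zero, ofReal_zero, mul_zero, add_zero, one_mul]
  map_β := by
    change |c x.X * 𝔄.chartSign x.X| * (1 : ℝ) = 1 * |𝔄.chartSign x.X|
    rw [abs_mul, abs_of_eq_one_or (hc x.X), mul_one]

/-- ★ **`η⊢_𝕏` is an ISOMORPHISM of `TB⊞`** `(k∼)^{TB⊞}(𝕏 ↶ k) ⥲ k∼(G_𝕏)`. [cite: MochizukiAbsTopIII2015, Cor 5.10 (iv)(c) p.148] -/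
noncomputable def etaTildeIso : TBPlus.uliftObj.{u + 1} (lamSimPlusObj x).toTBPlusObj ≅ TMMono.kTildeObj.{u + 1} :=
  TBPlus.isoMk (etaTildeApp c x hc) (etaTildeAppInv c x hc) (etaTildeInv_etaTildeHom c x hc)
    (etaTildeHom_etaTildeInv c x hc)

/-- The isomorphism's forward morphism is `etaTildeApp`. [cite: MochizukiAbsTopIII2015, Cor 5.10 (iv)(c) p.148] -/
@[simp] theorem etaTildeIso_hom : (etaTildeIso c x hc).hom = etaTildeApp c x hc := rfl

/-- The isomorphism's inverse is `etaTildeAppInv`. [cite: MochizukiAbsTopIII2015, Cor 5.10 (iv)(c) p.148] -/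
@[simp] theorem etaTildeIso_inv : (etaTildeIso c x hc).inv = etaTildeAppInv c x hc := rfl

end Component

/-! ## §4. Naturality in `(𝕏 ↶ k)`: `η⊢_{v,pre}` as an isomorphism of functors `𝒳 ⥤ TB⊞` -/

section Natural

variable (𝔄)
variable (c : 𝔄.EA → ℝ) (hc : ∀ X : 𝔄.EA, c X = 1 ∨ c X = -1)
  (hcob : ∀ {X Y : 𝔄.EA} (f : X ⟶ Y), AutHolFieldFunctor.transitionSign f = c X * c Y)
include hc hcob

/-- **NATURALITY SQUARE of `η⊢`**: for `φ : (𝕏 ↶ k) → (𝕐 ↶ k′)`, `η⊢_𝕐 ∘ (φ_M)^{TB⊞} = k∼(G_{φ_𝕏}) ∘ η⊢_𝕏` on elements —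
`(σ_𝕐 ε Im, c_𝕐 σ_𝕐 Re) = σ(G_φ) · (σ_𝕏 Im, c_𝕏 σ_𝕏 Re)` by `σ(G_φ) = ε σ_𝕏 σ_𝕐` (F3a) and `ε = c_𝕏 c_𝕐` (the cochain).
[cite: MochizukiAbsTopIII2015, Cor 5.10 (iv)(c) p.148] -/
theorem etaTildeHom_naturality {x y : HolTFPair 𝔄} (φ : x ⟶ y) (b : ULift.{u + 1} x.k) :
    etaTildeHom c y (ULift.up (φ.arith b.down)) =
      TMMono.signZ (𝔄.toTMMono.map φ.base) • etaTildeHom c x b := by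
  rw [etaTildeHom_apply, etaTildeHom_apply, im_cafChart_arith, re_cafChart_arith]
  change _ = ULift.up (TMMono.signZ (𝔄.toTMMono.map φ.base) • (_, _))
  refine congrArg ULift.up ?_
  rw [Prod.smul_mk, zsmul_eq_mul, zsmul_eq_mul, TMMono.cast_signZ, 𝔄.sign_toTMMono_map_eq, hcob φ.base]
  have h₁ := mul_self_of_eq_one_or (hc x.X)
  have h₂ := 𝔄.chartSign_mul_self x.X
  refine Prod.ext ?_ ?_
  · calc 𝔄.chartSign y.X * (c x.X * c y.X * (x.cafChart b.down).im)
        = c x.X * c y.X * (𝔄.chartSign x.X * 𝔄.chartSign x.X) * 𝔄.chartSign y.X *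
            (x.cafChart b.down).im := by rw [h₂]; ring
      _ = c x.X * c y.X * 𝔄.chartSign x.X * 𝔄.chartSign y.X *
            (𝔄.chartSign x.X * (x.cafChart b.down).im) := by ring
  · calc c y.X * 𝔄.chartSign y.X * (x.cafChart b.down).re
        = (c x.X * c x.X) * (𝔄.chartSign x.X * 𝔄.chartSign x.X) * c y.X * 𝔄.chartSign y.X *
            (x.cafChart b.down).re := by rw [h₁, h₂]; ring
      _ = c x.X * c y.X * 𝔄.chartSign x.X * 𝔄.chartSign y.X *
            (c x.X * 𝔄.chartSign x.X * (x.cafChart b.down).re) := by ring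

/-- ★★ **The archimedean `η⊢_{v,ν}` at `ν = pre`** (Cor 5.10 (iv)(c)): an isomorphism between the composite
`𝒳 → 𝒩⊞_v → 𝒩⊢⊞_v` (`λ⊞_pre`, then Def 5.6 (iv)'s `𝒞^hol_{TH⊞} → TB⊞`) and the composite `𝒳 → 𝒢 → ℰ⊢ → 𝒩⊢⊞_v`
(`(𝕏 ↶ k) ↦ 𝕏 ↦ G_𝕏 ↦ k∼(G_𝕏)`), on `TB⊞`-components, NATURAL in `(𝕏 ↶ k)` — under an orientation cochain `c`
for the transition signs. [cite: MochizukiAbsTopIII2015, Cor 5.10 (iv)(c) p.148] -/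
noncomputable def etaTilde : lamSimPlus 𝔄 ⋙ HolTHPlusPair.toTBPlus 𝔄 ⋙ TBPlus.uliftFunctor.{u + 1} ≅
    toEA 𝔄 ⋙ 𝔄.toTMMono ⋙ TMMono.kTilde :=
  NatIso.ofComponents (fun x => etaTildeIso c x hc) fun φ =>
    TBPlus.hom_ext_toHom (ContinuousAddMonoidHom.ext fun b => etaTildeHom_naturality 𝔄 c hc hcob φ b)

/-- The component of `η⊢` at `(𝕏 ↶ k)` is `η⊢_𝕏`. [cite: MochizukiAbsTopIII2015, Cor 5.10 (iv)(c) p.148] -/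
theorem etaTilde_hom_app (x : HolTFPair 𝔄) : (etaTilde 𝔄 c hc hcob).hom.app x = etaTildeApp c x hc := rfl

/-- The component of `η⊢⁻¹` at `(𝕏 ↶ k)` is `η⊢_𝕏⁻¹`. [cite: MochizukiAbsTopIII2015, Cor 5.10 (iv)(c) p.148] -/
theorem etaTilde_inv_app (x : HolTFPair 𝔄) : (etaTilde 𝔄 c hc hcob).inv.app x = etaTildeAppInv c x hc := rfl

end Natural

/-- **Existence form**: an orientation cochain for the transition signs yields the natural isomorphism `η⊢_{v,pre}`.
[cite: MochizukiAbsTopIII2015, Cor 5.10 (iv)(c) p.148] -/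
theorem nonempty_etaTilde_of_cochain (𝔄 : AutHolFieldFunctor.{u})
    (h : ∃ c : 𝔄.EA → ℝ, (∀ X, c X = 1 ∨ c X = -1) ∧
      ∀ {X Y : 𝔄.EA} (f : X ⟶ Y), AutHolFieldFunctor.transitionSign f = c X * c Y) :
    Nonempty (lamSimPlus 𝔄 ⋙ HolTHPlusPair.toTBPlus 𝔄 ⋙ TBPlus.uliftFunctor.{u + 1} ≅
      toEA 𝔄 ⋙ 𝔄.toTMMono ⋙ TMMono.kTilde) := by
  obtain ⟨c, hc, hcob⟩ := h
  exact ⟨etaTilde 𝔄 c hc hcob⟩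

end HolTFPair

/-! ## §5. The geometric case: `η⊢_{v,pre}` exists unconditionally -/

namespace HolRS

/-- ★★ **At the geometric Aut-holomorphic field functor of a class `Q` of hyperbolic Riemann surfaces the archimedean
`η⊢_{v,pre}` EXISTS unconditionally**: there all transition signs are `+1` (`𝒜_f` is the identity of `ℂ`), so the
constant cochain `1` works (`HolRS.exists_orientationCochain_geometric`). [cite: MochizukiAbsTopIII2015, Cor 5.10 (iv)(c) p.148] -/
theorem nonempty_etaTilde_geometric (Q : ObjectProperty HolRS) :
    Nonempty (HolTFPair.lamSimPlus (geometricAutHolFieldFunctor Q) ⋙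
        HolTHPlusPair.toTBPlus (geometricAutHolFieldFunctor Q) ⋙ TBPlus.uliftFunctor.{1} ≅
      HolTFPair.toEA (geometricAutHolFieldFunctor Q) ⋙ (geometricAutHolFieldFunctor Q).toTMMono ⋙ TMMono.kTilde) :=
  HolTFPair.nonempty_etaTilde_of_cochain _ (exists_orientationCochain_geometric Q)

end HolRS

end Literature.AnabelianGeometry.AbsoluteAnabelian
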